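import Summits.ResolutionOfSingularities.ResolutionOfSingularities.Theorems.PurelyInseparableDim4WinCertAllFieldsInert
import HarnessLib
import HarnessLib.Audit.Tags

/-!
# Purely inseparable fourfolds — win certificates over every field, v3: RATIONAL-curve blindness leaves go up too
# [OURS · counted 0 · a certificate format for OUR frame v4, not about resolution]

Census cell «res-dim4-pi» (D-0157 DOOR 2), width seat `res-dim4-p-14` (generation 2); completes
`…WinCertAllFieldsScope` (`.mono` leaves) / `…Inert` (v2 rows): here res-dim4-p-13's RATIONAL-curve blindness
certificates (`ScopeBlind.rblindB`, PR-12u's `BlindCert.rat`) are transported along the coefficient map `f : k →+* K` —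
not through power series, but by MAPPING THE CERTIFICATE: every term-list operation of the check commutes with `f`
(`mapC`; `hasseL_mapC`, `mulL_mapC`, `powL_mapC`, `prodPowL_mapC`, `rcurveLN_mapC`, `coeffAt_mapC`, `evalAtL_mapC`,
`maxV_mapC`), so the mapped data pass `rblindB` over `K` (`rblindB_mapC`), and p-13's own soundness applies there
(`not_inCoordinateScope_map_of_rblindB`); with `…Scope`'s mono lemma: **`not_inCoordinateScope_map_of_check`** — EVERY
PR-12u blindness certificate goes up.  The final row check `uirowOK3` = PR-12u's `blindOK` ∨ origin not `q`-fold ∨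
(move check over `k` ∧ `ratOK2`), checker `uiwinCertB3 p q`, soundness **`inScopeStateWins_map_of_uiwinCertB3`** /
`forall_inScopeStateWins_of_uiwinCertB3`.  Acceptance (`decide`): p-13's polynomial-numerator rational specimen
`ScopeBlind.r1poly` (its landed witness `rblindB_r1poly`) as a one-row certificate (`r1polyU`): blind, hence in-scope
escapable, over EVERY field of characteristic 2.
Nothing here proves resolution of singularities in dimension ≥ 4 / characteristic `p`; counted 0; AI work, weaker
than expert review.  bears_on: LADDER-RESOLUTION:D157-DOOR2 (res-dim4-pi · F4-C instrument · ∀K gap).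
Supports stmt-ResolutionOfSingularities-16155 (helper).
-/

set_option linter.dupNamespace false

noncomputable section
open MvPolynomial Finset
open scoped BigOperators
namespace Summit.ResolutionOfSingularities.ResolutionOfSingularities.Theorems.PIDim4

namespace WinCertAllFields

open Literature.AlgebraicGeometry.Resolution
open Literature.AlgebraicGeometry.Resolution.CentreBlowup
open StepKit WinCertSound InScopeWinCert ScopeCover ScopeBlind

variable {k K : Type} [Field k] [Field K] (f : k →+* K)

/-! ## 1. Term-list operations commute with the coefficient map -/

/-- Coefficient map on term lists. [folklore] -/
def mapC {n : ℕ} (f : k →+* K) (L : Terms n k) : Terms n K := L.map fun t => (t.1, f t.2)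

omit [Field K] in
/-- `mapC` on the presented polynomial. [folklore] -/
theorem evalT_mapC {K : Type} [CommRing K] (f : k →+* K) {n : ℕ} (L : Terms n k) :
    evalT (L.map fun t => (t.1, f t.2)) = MvPolynomial.map f (evalT L) := by
  induction L with
  | nil => simp
  | cons t L ih => rw [List.map_cons, evalT_cons, evalT_cons, map_add, map_monomial, ih]

/-- `mapC` on `coeffAt`. [folklore] -/
theorem coeffAt_mapC {n : ℕ} (L : Terms n k) (e : Fin n → ℕ) : coeffAt (mapC f L) e = f (coeffAt L e) := by
  induction L with
  | nil => simp [mapC, coeffAt]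
  | cons t L ih =>
    simp only [mapC, List.map_cons, coeffAt] at ih ⊢
    rw [ih, map_add]
    congr 1
    split_ifs <;> simp

/-- `mapC` on `hasseL`. [folklore] -/
theorem hasseL_mapC (α : Fin 4 → ℕ) (L : Terms 4 k) : hasseL α (mapC f L) = mapC f (hasseL α L) := by
  simp only [hasseL, mapC, List.map_map]
  congr 1
  funext t
  simp only [Function.comp_apply]
  congr 1
  split_ifs
  · rw [map_mul, map_prod]; simp only [map_natCast]
  · rw [map_zero]

/-- `mapC` on `mulTL`. [folklore] -/
theorem mulTL_mapC {n : ℕ} (t : (Fin n → ℕ) × k) (B : Terms n k) :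
    mulTL (t.1, f t.2) (mapC f B) = mapC f (mulTL t B) := by
  simp only [mulTL, mapC, List.map_map]
  congr 1
  funext u
  simp only [Function.comp_apply, map_mul]

/-- `mapC` on `mulL`. [folklore] -/
theorem mulL_mapC {n : ℕ} : ∀ (A B : Terms n k), mulL (mapC f A) (mapC f B) = mapC f (mulL A B)
  | [], B => by simp [mulL, mapC]
  | t :: A, B => by
    have ih := mulL_mapC A B
    simp only [mapC, List.map_cons] at ih ⊢
    rw [mulL, mulL, List.map_append, ← ih]
    congr 1
    exact mulTL_mapC f t B

/-- `mapC` on `powL`. [folklore] -/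
theorem powL_mapC {n : ℕ} (D : Terms n k) : ∀ m : ℕ, powL (mapC f D) m = mapC f (powL D m)
  | 0 => by simp [powL, mapC]
  | m + 1 => by rw [powL, powL, powL_mapC D m, mulL_mapC]

/-- `mapC` on `prodPowL`. [folklore] -/
theorem prodPowL_mapC (P : Fin 4 → Terms 1 k) (e : Fin 4 → ℕ) :
    prodPowL (fun i => mapC f (P i)) e = mapC f (prodPowL P e) := by
  simp only [prodPowL, powL_mapC, mulL_mapC]

omit [Field K] in
/-- `vdeg`-weights are untouched by `mapC`, hence so is `maxV`. [folklore] -/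
theorem maxV_mapC {K : Type} [Field K] (f : k →+* K) (v : Fin 4 → ℕ) (L : Terms 4 k) :
    maxV v (mapC f L) = maxV v L := by
  simp only [maxV, mapC, List.map_map]
  rfl

/-- `mapC` on the cleared rational-curve evaluation `rcurveLN`. [folklore] -/
theorem rcurveLN_mapC (P : Fin 4 → Terms 1 k) (v : Fin 4 → ℕ) (D : Terms 1 k) (N : ℕ) :
    ∀ L : Terms 4 k, rcurveLN (fun i => mapC f (P i)) v (mapC f D) N (mapC f L) = mapC f (rcurveLN P v D N L)
  | [] => by simp [rcurveLN, mapC]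
  | t :: L => by
    have ih := rcurveLN_mapC P v D N L
    simp only [mapC, List.map_cons] at ih ⊢
    rw [rcurveLN, rcurveLN, List.map_append, ← ih]
    congr 1
    have h1 := prodPowL_mapC f P t.1
    have h2 := powL_mapC f D (N - vdeg v t.1)
    simp only [mapC] at h1 h2
    rw [h1, h2]
    have h3 := mulL_mapC f (prodPowL P t.1) (powL D (N - vdeg v t.1))
    simp only [mapC] at h3
    rw [h3]
    have h4 := mulTL_mapC f ((fun _ : Fin 1 => 0), t.2) (mulL (prodPowL P t.1) (powL D (N - vdeg v t.1)))
    simp only [mapC] at h4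
    exact h4

/-- `mapC` on `evalAtL`. [folklore] -/
theorem evalAtL_mapC (a : Fin 4 → k) : ∀ L : Terms 4 k, evalAtL (f ∘ a) (mapC f L) = f (evalAtL a L)
  | [] => by simp [evalAtL, mapC]
  | t :: L => by
    have ih := evalAtL_mapC a L
    simp only [evalAtL, mapC, List.map_cons, List.sum_cons] at ih ⊢
    rw [map_add, ih, map_mul, map_prod]
    simp only [Function.comp_apply, map_pow]

/-! ## 2. Rational-curve blindness certificates go up -/

/-- Mapped presented state. [folklore] -/
def SDataMapC (f : k →+* K) (s : SData 4 k) : SData 4 K := ⟨mapC f s.L, s.r, s.exc⟩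

variable [DecidableEq k] [DecidableEq K]

/-- `equivB · []` is invariant under `mapC` (injectivity of `f`). [folklore] -/
theorem equivB_nil_mapC {n : ℕ} (L : Terms n k) : StepKit.equivB (mapC f L) [] = StepKit.equivB L [] := by
  rw [Bool.eq_iff_iff, ← evalT_eq_zero_iff, ← evalT_eq_zero_iff, mapC, evalT_mapC]
  constructor
  · intro h
    exact MvPolynomial.map_injective f f.injective (by rw [h, map_zero])
  · intro h
    rw [h, map_zero]

/-- **The mapped data pass `rblindB` over `K`.** [folklore] -/
theorem rblindB_mapC {q : ℕ} {s : SData 4 k} {P : Fin 4 → Terms 1 k} {v : Fin 4 → ℕ} {D : Terms 1 k}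
    {kk α₀ : Fin 4 → ℕ} {a : Fin 4 → k} (h : rblindB q s P v D kk α₀ a = true) :
    rblindB q (SDataMapC f s) (fun i => mapC f (P i)) v (mapC f D) kk α₀ (f ∘ a) = true := by
  simp only [rblindB, Bool.and_eq_true, decide_eq_true_eq, List.all_eq_true, Bool.not_eq_true',
    decide_eq_false_iff_not] at h ⊢
  obtain ⟨⟨⟨⟨⟨hP, hD⟩, hJ⟩, ha⟩, hα₀⟩, hne⟩ := h
  refine ⟨⟨⟨⟨⟨fun i => ?_, ?_⟩, fun α hα => ?_⟩, fun i hi => ?_⟩, hα₀⟩, ?_⟩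
  · rw [coeffAt_mapC, hP i, map_zero]
  · rw [coeffAt_mapC, map_eq_zero_iff f f.injective]; exact hD
  · have hs : (SDataMapC f s).L = mapC f s.L := rfl
    rw [hs, hasseL_mapC, maxV_mapC, rcurveLN_mapC, equivB_nil_mapC]
    exact hJ α hα
  · rw [coeffAt_mapC, map_eq_zero_iff f f.injective] at hi
    rw [Function.comp_apply, ha i hi, map_zero]
  · have hs : (SDataMapC f s).L = mapC f s.L := rfl
    rw [hs, hasseL_mapC, evalAtL_mapC, map_eq_zero_iff f f.injective]
    exact hne

/-- **A rational-curve blindness certificate over `k` certifies blindness over every `K ⊇ k`.** [folklore] -/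
theorem not_inCoordinateScope_map_of_rblindB {q : ℕ} {s : SData 4 k} {P : Fin 4 → Terms 1 k} {v : Fin 4 → ℕ}
    {D : Terms 1 k} {kk α₀ : Fin 4 → ℕ} {a : Fin 4 → k} (h : rblindB q s P v D kk α₀ a = true) :
    ¬ InCoordinateScope q (MvPolynomial.map f (evalT s.L)) := by
  have h1 := not_inCoordinateScope_of_rblindB (rblindB_mapC f h)
  rw [SData.toState_F] at h1
  have hs : (SDataMapC f s).L = mapC f s.L := rfl
  rwa [hs, mapC, evalT_mapC] at h1

/-- **Every PR-12u blindness certificate goes up** (`.mono` by `…Scope`, `.rat` by the above). [folklore] -/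
theorem not_inCoordinateScope_map_of_check {q : ℕ} {s : SData 4 k} :
    ∀ {β : BlindCert k}, β.check q s = true → ¬ InCoordinateScope q (MvPolynomial.map f (evalT s.L))
  | .mono _ _ _ _, h => not_inCoordinateScope_map_of_blindB f h
  | .rat _ _ _ _ _ _, h => not_inCoordinateScope_map_of_rblindB f h

/-! ## 3. The final in-scope format (v3) and its soundness over every field -/

variable [Fintype k]

/-- The v3 row check: ANY PR-12u blindness certificate (`blindOK`), or origin not `q`-fold, or the move check over
`k` with `ratOK2` (inert-or-forced). [folklore] -/
def uirowOK3 (p q : ℕ) (rest : UICert k) (row : UIRow k) : Bool :=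
  blindOK q row.1 || !(permB q Finset.univ row.1.1.L) ||
    ((permB q row.1.2.1 row.1.1.L &&
      decide (∀ j ∈ row.1.2.1, ∀ b : Fin 4 → k, b j = 0 →
        ireplyOK q (rest.map Prod.fst) row.1.1 row.1.2.1 j b = true)) &&
      ratOK2 p q ((row.1.1, row.1.2.1), row.2))

/-- **The v3 checker.** [folklore] -/
def uiwinCertB3 (p q : ℕ) : UICert k → Bool
  | [] => true
  | row :: rest => uirowOK3 p q rest row && uiwinCertB3 p q rest

omit [DecidableEq K] in
/-- **SOUNDNESS of one v3 row over `K`.** [folklore] -/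
theorem inScopeStateWins_map_of_uirowOK3 {p : ℕ} [Fact p.Prime] {q : ℕ} {K : Type} [Field K] [CharP K p]
    [DecidableEq K] (f : ZMod p →+* K) {rest : UICert (ZMod p)}
    (hrest : ∀ r ∈ rest, InScopeStateWins q
      (⟨MvPolynomial.map f r.1.1.toState.F, r.1.1.toState.r, r.1.1.toState.exc⟩ : State K))
    {row : UIRow (ZMod p)} (h : uirowOK3 p q rest row = true) :
    InScopeStateWins q
      (⟨MvPolynomial.map f row.1.1.toState.F, row.1.1.toState.r, row.1.1.toState.exc⟩ : State K) := by
  unfold uirowOK3 at h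
  rw [Bool.or_eq_true, Bool.or_eq_true] at h
  rcases h with (hb | ht) | hm
  · unfold blindOK at hb
    obtain ⟨⟨s, S, oβ⟩, ws⟩ := row
    cases oβ with
    | none => exact absurd hb Bool.false_ne_true
    | some β => exact inScopeStateWins_of_not_inCoordinateScope (not_inCoordinateScope_map_of_check f hb)
  · rw [Bool.not_eq_true'] at ht
    refine inScopeStateWins_of_no_permissible fun S hS => ?_
    exact no_permissible_of_not_permB ht S ((BaseChange.isPermissibleCentre_map_iff f q S _).mp hS)
  · rw [Bool.and_eq_true, Bool.and_eq_true, decide_eq_true_eq] at hm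
    obtain ⟨⟨hS, hall⟩, hrat⟩ := hm
    have hperm : IsPermissibleCentre q row.1.2.1 row.1.1.toState.F :=
      (isPermissibleCentre_iff q row.1.2.1 row.1.1.L).mpr hS
    refine inScopeStateWins_move row.1.2.1 ((BaseChange.isPermissibleCentre_map_iff f q row.1.2.1 _).mpr hperm) ?_
    rintro s' ⟨j, b, hj, hbj, heq, hne, rfl⟩
    obtain ⟨b₀, hb₀j, hstep, heq'⟩ :=
      exists_reply_of_ratOK2 f (row := ((row.1.1, row.1.2.1), row.2)) hrat hj hbj heq
    have heq₀ : IsEquimultiplePoint q row.1.2.1 j b₀ row.1.1.toState :=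
      (BaseChange.isEquimultiplePoint_map_ringHom_iff f q row.1.2.1 j b₀ row.1.1.toState).mp heq'
    have hmap := BaseChange.step_map f q row.1.2.1 j b₀ row.1.1.toState
    have h := hall j hj b₀ hb₀j
    unfold ireplyOK at h
    rw [Bool.or_eq_true, Bool.or_eq_true] at h
    rcases h with (h1 | h2) | h3
    · rw [Bool.not_eq_true', ← Bool.not_eq_true] at h1
      exact absurd ((isEquimultiplePoint_iff q row.1.2.1 j b₀ row.1.1).mp heq₀) h1
    · exfalso
      apply hne
      rw [hstep, hmap]
      show MvPolynomial.map f (step q row.1.2.1 j b₀ row.1.1.toState).F = 0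
      have hz : (step q row.1.2.1 j b₀ row.1.1.toState).F = 0 := by
        by_contra hnz
        have := (step_F_ne_zero_iff q row.1.2.1 j b₀ row.1.1).mp hnz
        rw [h2] at this
        exact Bool.noConfusion this
      rw [hz, map_zero]
    · obtain ⟨r, hr, hrc⟩ := exists_of_ichildIn h3
      obtain ⟨ur, hur, rfl⟩ := List.mem_map.mp hr
      change InScopeStateWins q (step q row.1.2.1 j b _)
      rw [hstep, hmap, step_toState, hrc]
      exact hrest ur hur

omit [DecidableEq K] in
/-- **SOUNDNESS OVER EVERY FIELD OF CHARACTERISTIC `p` (v3).** [folklore] -/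
theorem inScopeStateWins_map_of_uiwinCertB3 {p : ℕ} [Fact p.Prime] {q : ℕ} {K : Type} [Field K] [CharP K p]
    [DecidableEq K] (f : ZMod p →+* K) :
    ∀ {T : UICert (ZMod p)}, uiwinCertB3 p q T = true →
      ∀ row ∈ T, InScopeStateWins q
        (⟨MvPolynomial.map f row.1.1.toState.F, row.1.1.toState.r, row.1.1.toState.exc⟩ : State K)
  | [], _ => fun row hrow => absurd hrow List.not_mem_nil
  | row :: rest, h => by
    unfold uiwinCertB3 at h
    rw [Bool.and_eq_true] at h
    have hrest := inScopeStateWins_map_of_uiwinCertB3 f h.2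
    intro r hr
    rcases List.mem_cons.mp hr with rfl | hr'
    · exact inScopeStateWins_map_of_uirowOK3 f hrest h.1
    · exact hrest r hr'

omit [DecidableEq K] in
/-- **`∀ K` form (v3).** [folklore] -/
theorem forall_inScopeStateWins_of_uiwinCertB3 {p : ℕ} [Fact p.Prime] {q : ℕ} {T : UICert (ZMod p)}
    (h : uiwinCertB3 p q T = true) (K : Type) [Field K] [CharP K p] [DecidableEq K] :
    ∀ row ∈ T, InScopeStateWins q
      (⟨MvPolynomial.map (ZMod.castHom (dvd_refl p) K) row.1.1.toState.F, row.1.1.toState.r,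
        row.1.1.toState.exc⟩ : State K) :=
  inScopeStateWins_map_of_uiwinCertB3 (ZMod.castHom (dvd_refl p) K) h

/-! ## 4. Acceptance: PR-12u's rational specimen as a one-row certificate over every field of characteristic 2 -/

/-- p-13's RUN-1 trap state `r1poly` (`ScopeBlindRational` §4: blind by the rational curve with a POLYNOMIAL
numerator, `rblindB_r1poly`) as a one-row certificate. [folklore] -/
def r1polyU : UICert (ZMod 2) :=
  [((r1poly, ∅, some (.rat ![[], [(![1], 1)], [(![1], 1), (![2], 1), (![3], 1)], [(![1], 1)]] ![0, 0, 0, 0]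
      onePlusT ![0, 1, 1, 1] ![0, 0, 1, 0] ![0, 0, 0, 1])), [])]

/-- The one-row certificate checks (`p = q = 2`). [folklore] -/
theorem uiwinCertB3_r1polyU : uiwinCertB3 2 2 r1polyU = true := by
  decide

/-- **Over EVERY field `K` of characteristic 2, `r1poly ⊗ K` is in-scope escapable (indeed BLIND).** [OURS · ‖ K] [folklore] -/
theorem forall_inScopeStateWins_r1polyU (K : Type) [Field K] [CharP K 2] [DecidableEq K] :
    ∀ row ∈ r1polyU, InScopeStateWins 2
      (⟨MvPolynomial.map (ZMod.castHom (dvd_refl 2) K) row.1.1.toState.F, row.1.1.toState.r,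
        row.1.1.toState.exc⟩ : State K) :=
  forall_inScopeStateWins_of_uiwinCertB3 uiwinCertB3_r1polyU K

end WinCertAllFields

end Summit.ResolutionOfSingularities.ResolutionOfSingularities.Theorems.PIDim4

end
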